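import Mathlib
import HarnessLib
import Summits.HubbardSuperconductivity.HubbardSuperconductivity.Theorems.KLProgrammeKLRegimeWickBlockGluing
import Literature.Probability.LatticeModels.UrsellExplicitFormula

/-!
# Route `KLProgramme` — ENGINE child (E2-v9): the WICK CUMULANT PARTITION FORMULA
# (E2-WICK-ROADMAP §5 (i), second half; cell gate-hubbard-kl, seat p1 g8)

On the replica labels `Fin n × Γ` (clusters = replicas, `cl = Prod.fst`): `M′ a` = the Wick-ORDERED vertex `e^{−Δ_{D+C}} w_a` placed in replica `a`,
`M a` = the Wick vertex `w_a` placed in replica `a`, `m′ = convMoment (allCov C) M′` (the plain `C`-moments of the step), `ν = convMoment (offCov (D+C)) M`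
(the Wick moments: inter-replica lines only, p489692).  Then for every nonempty set `W` of replicas:

  `e^{Δ_{allCov D}} ( 𝓔ᵀ_C(W) ) = Σ_{π ∈ setPartitions W} (−1)^{|π|−1} (|π|−1)! · e^{Δ_{interCov π (allCov D)}} ( ∏_{B∈π} ν(B) )`      (`wickCumulant_partition`)

where `𝓔ᵀ_C(W) = ursellOf m′ W` is the truncated expectation of the step (connected in the `C`-lines) and `interCov π (allCov D)` = the soft lines BETWEEN
different blocks of `π`.  In words: the soft smearing of the step's cumulant is the Möbius sum over partitions of the replicas into blocks, each block carrying
its WICK moment (all inter-replica `D+C` lines inside the block, no self-lines), the blocks glued by inter-block `D`-lines only.  (The familiar reading —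
«g-connected graphs, D-lines anywhere between distinct vertices, no self-contraction» — is this formula after expanding each `ν(B)` in `treeOp`
form, `ursellOf_wickMoment_eq_treeOp`.)  Ingredients: `ursellOf_eq_sum_setPartitions` (Möbius), `gaussConv_prod_blocks` (gluing, p490508),
`evenGaussConv_allCov_convMoment_eq` (Wick moments, p489692), and `gaussConv_inCov_eq_of_mem` (pairs with a leg outside a block's support act trivially).
Proved; no definitions; nothing about the model is asserted.
-/

noncomputable section

namespace Summit.HubbardSuperconductivity.HubbardSuperconductivity.Theorems.KLRegimeWick

set_option linter.dupNamespace false -- summit = problem name (single-conjunct summit), D-0017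

open Literature.MathematicalPhysics.QuantumLattice GrassmannAlgebra Finset Matrix
open Literature.Probability.LatticeModels

section Generic

variable (R : Type*) [CommRing R] [Algebra ℚ R] {Γ' : Type*} [Fintype Γ'] [DecidableEq Γ'] {ι : Type*} [DecidableEq ι] (cl : Γ' → ι)

/-- **A covariance charging only pairs with a leg outside `S` fixes the elements supported on `S`.** -/
theorem gaussConv_eq_self_of_mem (C' : Matrix Γ' Γ' R) {S : Set Γ'} (hC : ∀ X Y, X ∈ S → Y ∈ S → C' X Y = 0)
    {a : GrassmannAlgebra R Γ'} (ha : a ∈ fieldSubalgebra R S) : gaussConv R C' a = a := by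
  rw [gaussConv_def]
  exact exp_apply_eq_self_of_apply_eq_zero R (isNilpotent_grassmannLaplacian R C') (grassmannLaplacian_eq_zero_of_mem R C' hC ha)

omit [DecidableEq ι] in
/-- **Restricting to a block costs nothing on block-supported elements**: `e^{Δ_{inCov A E}} a = e^{Δ_E} a` for `a` supported on the clusters of `A`. -/
theorem gaussConv_inCov_eq_of_mem (A : Set ι) [DecidablePred (· ∈ A)] (E : Matrix Γ' Γ' R) {a : GrassmannAlgebra R Γ'}
    (ha : a ∈ fieldSubalgebra R (cl ⁻¹' A)) : gaussConv R (inCov R cl A E) a = gaussConv R E a := by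
  have hE := cov_eq_in_add_out_add_cross R cl A E
  conv_rhs => rw [hE, add_assoc, gaussConv_add_apply]
  rw [gaussConv_eq_self_of_mem R (outCov R cl A E + crossCovOf R cl A E) (S := cl ⁻¹' A) ?_ ha]
  intro X Y hX hY
  simp only [Set.mem_preimage] at hX hY
  simp [outCov, crossCovOf, hX, hY]

end Generic

section Replica

variable (R : Type*) [CommRing R] [Algebra ℚ R] {Γ : Type*} [Fintype Γ] [DecidableEq Γ] {n : ℕ}

/-- The Wick-ordered replicas `M′ a` and their `C`-moments are supported on their replica sets. -/
theorem coe_convMoment_replica_mem (C' : Matrix (Fin n × Γ) (Fin n × Γ) R) (x : Fin n → evenPart R Γ) (B : Finset (Fin n)) :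
    ((convMoment R C' (fun a => replicaCopyEven R a (x a)) B : evenPart R (Fin n × Γ)) : GrassmannAlgebra R (Fin n × Γ)) ∈
      fieldSubalgebra R ((Prod.fst : Fin n × Γ → Fin n) ⁻¹' (↑B : Set (Fin n))) := by
  rw [convMoment, coe_evenGaussConv]
  exact gaussConv_mem_fieldSubalgebra R _
    (coe_prod_mem_fieldSubalgebra_preimage R (Prod.fst : Fin n × Γ → Fin n) (fun v => coe_replicaCopyEven_mem_cluster R x v) B)

/-- **`wickCumulant_partition` — the Wick cumulant partition formula.**  With `M′ a = copy_a(e^{−Δ_{D+C}} w_a)`, `M a = copy_a(w_a)`,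
`ν = convMoment (offCov (D+C)) M`, for every nonempty `W`:
`e^{Δ_{allCov D}}(ursellOf (convMoment (allCov C) M′) W) = Σ_{π ∈ setPartitions W} (−1)^{|π|−1}(|π|−1)! • e^{Δ_{interCov fst π (allCov D)}}(∏_{B∈π} ν B)`. -/
theorem wickCumulant_partition (C D : Matrix Γ Γ R) (w : Fin n → evenPart R Γ) {W : Finset (Fin n)} (hW : W.Nonempty) :
    gaussConv R (allCov R D)
        ((ursellOf (convMoment R (allCov R C) (fun a => replicaCopyEven R a ⟨gaussConv R (-(D + C)) (w a), gaussConv_neg_mem_evenPart R _ (w a)⟩)) W :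
          evenPart R (Fin n × Γ)) : GrassmannAlgebra R (Fin n × Γ)) =
      ∑ π ∈ setPartitions W, ((-1 : R) ^ (π.card - 1) * ((π.card - 1).factorial : R)) •
        gaussConv R (interCov R (Prod.fst : Fin n × Γ → Fin n) π (allCov R D))
          ((∏ B ∈ π, convMoment R (offCov R (D + C)) (fun a => replicaCopyEven R a (w a)) B : evenPart R (Fin n × Γ)) :
            GrassmannAlgebra R (Fin n × Γ)) := by
  set M' : Fin n → evenPart R (Fin n × Γ) := fun a =>
    replicaCopyEven R a ⟨gaussConv R (-(D + C)) (w a), gaussConv_neg_mem_evenPart R _ (w a)⟩ with hM'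
  set M : Fin n → evenPart R (Fin n × Γ) := fun a => replicaCopyEven R a (w a) with hM
  -- Möbius form of the Ursell function (moments multiplicative over the blocks)
  rw [ursellOf_eq_sum_setPartitions _ (convMoment_empty R _ M') hW]
  rw [AddSubmonoidClass.coe_finsetSum, map_sum]
  refine Finset.sum_congr rfl fun π hπ => ?_
  have hπ' : IsSetPartition W π := mem_setPartitions.1 hπ
  -- the coefficient is a scalar
  have hcoef : (((-1 : evenPart R (Fin n × Γ)) ^ (π.card - 1) * ((π.card - 1).factorial : evenPart R (Fin n × Γ)) *
      ∏ B ∈ π, convMoment R (allCov R C) M' B : evenPart R (Fin n × Γ)) : GrassmannAlgebra R (Fin n × Γ)) =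
      ((-1 : R) ^ (π.card - 1) * ((π.card - 1).factorial : R)) •
        ((∏ B ∈ π, convMoment R (allCov R C) M' B : evenPart R (Fin n × Γ)) : GrassmannAlgebra R (Fin n × Γ)) := by
    rw [Subalgebra.coe_mul, Subalgebra.coe_mul, Algebra.smul_def, map_mul, map_pow, map_neg, map_one, map_natCast]
    simp
  rw [hcoef, map_smul]
  congr 1
  -- block gluing with `E = allCov D`, clusters = replicas, blocks of `π`
  have hdisj : ∀ B ∈ π, ∀ B' ∈ π, B ≠ B' → Disjoint B B' := fun B hB B' hB' hne => hπ'.disjoint hB hB' hne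
  rw [gaussConv_prod_blocks R (Prod.fst : Fin n × Γ → Fin n) (fun B => convMoment R (allCov R C) M' B)
    (fun B => coe_convMoment_replica_mem R _ _ B) π hdisj (allCov R D)]
  congr 2
  refine Finset.prod_congr rfl fun B _ => Subtype.ext ?_
  -- inside a block: restrict freely, then the Wick-moment identity
  change gaussConv R (inCov R Prod.fst (↑B : Set (Fin n)) (allCov R D)) (convMoment R (allCov R C) M' B : GrassmannAlgebra R (Fin n × Γ)) =
    (convMoment R (offCov R (D + C)) M B : GrassmannAlgebra R (Fin n × Γ))
  rw [gaussConv_inCov_eq_of_mem R Prod.fst (↑B : Set (Fin n)) (allCov R D) (coe_convMoment_replica_mem R _ _ B)]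
  have h := congrArg Subtype.val (evenGaussConv_allCov_convMoment_eq R C D w B)
  simpa only [coe_evenGaussConv] using h

end Replica

end Summit.HubbardSuperconductivity.HubbardSuperconductivity.Theorems.KLRegimeWick

end
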